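import Literature.NumberTheory.EllipticCurves.IntSeriesNodeTransport
import Literature.NumberTheory.LocalFields.BinomialTwistExponentDenseValued
import Mathlib.Tactic
import HarnessLib

set_option autoImplicit false

/-!
# Transport of `𝒪_{ℂ_p}⟦T⟧` along a geometric progression of nodes WITHOUT unit content:
# `F' = c·(1+T)^z·F`, `z ∈ ℤ_p`, and the ratio is `d = u^z`

Topic `NumberTheory/EllipticCurves` (receptacle `𝒪_{ℂ_p}⟦T⟧`, values `IntSeries.HasValueAt`). Sequel of
`IntSeriesNodeTransport.lean`, whose transport theorem `exists_unit_binomPow_of_values_proportional`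
asks BOTH series to have a unit coefficient. Over `𝒪_{ℂ_p}` the supremum of the coefficient norms of an
integral series need not be attained, so that hypothesis is not a normalisation; the analytic input
without it is `LocalFields/BinomialTwistExponentDenseValued.lean`
(`PadicComplex.exists_padicInt_binomial_twist_of_node_values`: Gouvêa's integrality argument run on the
closed subdiscs `‖x‖ ≤ ‖a‖`, `‖a‖ → 1`). This file is the bridge to the `IntSeries` currency, in the
sharper form in which the CONSTANT is identified:

* **`map_eq_C_mul_binomPow_mul_of_values_proportional`** — `F, F' ∈ 𝒪_{ℂ_p}⟦T⟧`, `u ∈ ℂ_p` a one-unit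
  which is not a root of unity, `c, d ∈ ℂ_pˣ`, values `x_t = F(uᵗ − 1)`, `x'_t = F'(uᵗ − 1)` with
  `x'_t = c·dᵗ·x_t` for all `t ∈ ℕ` and ONE `x_{t₀} ≠ 0` ⟹ for some `z ∈ ℤ_p`:
  `F' = c·(1+T)^z·F` (read in `ℂ_p⟦T⟧`) AND `d = u^z` (`= onePlusPow z (u − 1)`).
* **`eq_C_mul_binomPow_mul_of_values_proportional`** — if moreover `c ∈ 𝒪_{ℂ_p}`, the identity
  `F' = C c · binomPow z · F` holds in `𝒪_{ℂ_p}⟦T⟧` itself.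
Mechanism: `F' = Q·F`, `(1+X)Q′ = zQ` (dense-valued node theorem) ⟹ `Q = Q(0)·(1+X)^z` (uniqueness of
solutions, `constantCoeff_smul_eq_of_ode`, `ode_binomPow_map`) ⟹ `x'_t = Q(0)·(uᵗ)^z·x_t`; `F` has only
finitely many zero nodes (identity principle on the closed disc `‖x‖ ≤ ‖u − 1‖`), so two consecutive
good nodes give `d = u^z` and then `Q(0) = c`.

USE (cell `bsd-print-cf2`, route C, the «(R) period-rigidity» lane of item 23722): on every monomial
line of two Katz–de Shalit frames of one branch at two period triples the node values are proportional
by `(c_s/D_s)·D_s^{t}` (`KatzPeriodRigidityOrigin`); this file turns that into the exact line identity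
`G'|_ℓ = C₀·(1+T)^{z_ℓ}·G|_ℓ`, `D_ℓ = g^{z_ℓ}`, the one-variable half of the full rigidity theorem.
THEOREMS ONLY (no definition, no named fact, no `sorry`).

## References

* F. Q. Gouvêa, *p-adic Numbers*, Universitext, Springer 1993, §5.9 Lemma 5.9.1, Problem 194.
  [Gouvea1993PadicNumbers]
* A. M. Robert, *A Course in p-adic Analysis*, GTM 198, Springer 2000, Ch. V §2.4 Theorem 1,
  Ch. VI §2.1 (Strassman). [Robert2000PadicAnalysis]
* N. Koblitz, *p-adic Numbers, p-adic Analysis, and Zeta-Functions*, GTM 58, Ch. IV §1 (the binomial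
  series `(1+X)^a`, `a ∈ ℤ_p`). [Koblitz1984]
-/

noncomputable section

open scoped Classical
open Filter Topology PowerSeries Finset
open Literature.NumberTheory.LocalFields

namespace Literature.NumberTheory.EllipticCurves.IntSeries

variable {p : ℕ} [Fact p.Prime]

/-- `‖u‖ = 1` for a one-unit `u`. [folklore] -/
private theorem ntn_norm_eq_one_of_oneUnit {u : ℂ_[p]} (hu : ‖u - 1‖ < 1) : ‖u‖ = 1 := by
  have hh := IsUltrametricDist.norm_add_eq_max_of_norm_ne_norm (x := u - 1) (y := (1 : ℂ_[p]))
    (by rw [norm_one]; exact hu.ne)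
  rw [sub_add_cancel, norm_one] at hh; rw [hh]; exact max_eq_right hu.le

/-- `‖uᵗ − 1‖ ≤ ‖u − 1‖` for a one-unit `u`. [folklore] -/
private theorem ntn_norm_pow_sub_one_le {u : ℂ_[p]} (hu : ‖u - 1‖ < 1) (t : ℕ) :
    ‖u ^ t - 1‖ ≤ ‖u - 1‖ := by
  rw [← geom_sum_mul, norm_mul]
  refine mul_le_of_le_one_left (norm_nonneg _) ?_
  refine IsUltrametricDist.norm_sum_le_of_forall_le_of_nonneg zero_le_one fun i _ ↦ ?_
  rw [norm_pow, ntn_norm_eq_one_of_oneUnit hu, one_pow]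

/-- Values of `C c · H` read in `ℂ_p⟦T⟧` (`c ∈ ℂ_p`, `H` integral): if `H(y) = w` then
`Σ [Tⁿ](C c · H.map) yⁿ = c·w`. [cite: Koblitz1984, Ch. IV §1] -/
private theorem ntn_hasSum_C_mul_map {H : PowerSeries (PadicComplexInt p)} {y w : ℂ_[p]} (c : ℂ_[p])
    (h : IntSeries.HasValueAt H y w) :
    HasSum (fun n : ℕ ↦ coeff n (C c * H.map (PadicComplexInt p).toSubring.subtype) * y ^ n) (c * w) := by
  have h2 := h.mul_left c
  refine h2.congr_fun fun n ↦ ?_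
  rw [coeff_C_mul, coeff_map_subtype, mul_assoc]

/-- **Proportional node values force a binomial twist — no unit content, constant identified.**
Let `F, F' ∈ 𝒪_{ℂ_p}⟦T⟧`, `u ∈ ℂ_p` a one-unit which is not a root of unity, `c, d ≠ 0`, and let
`x_t = F(uᵗ − 1)`, `x'_t = F'(uᵗ − 1)` satisfy `x'_t = c·dᵗ·x_t` for all `t ∈ ℕ` with one
`x_{t₀} ≠ 0`. Then for some `z ∈ ℤ_p`: `F' = c·(1+T)^z·F` in `ℂ_p⟦T⟧` and `d = u^z`.
[cite: Gouvea1993PadicNumbers, §5.9 Lemma 5.9.1 (converse) and Problem 194]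
[cite: Robert2000PadicAnalysis, Ch. V §2.4 Theorem 1; Ch. VI §2.1 Theorem (Strassman)] -/
theorem map_eq_C_mul_binomPow_mul_of_values_proportional {F F' : PowerSeries (PadicComplexInt p)}
    {u c d : ℂ_[p]} {x x' : ℕ → ℂ_[p]} (hu : ‖u - 1‖ < 1) (hroot : ∀ n : ℕ, 0 < n → u ^ n ≠ 1)
    (hc : c ≠ 0) (hd : d ≠ 0) (hx : ∀ t : ℕ, IntSeries.HasValueAt F (u ^ t - 1) (x t))
    (hx' : ∀ t : ℕ, IntSeries.HasValueAt F' (u ^ t - 1) (x' t))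
    (hrel : ∀ t : ℕ, x' t = c * d ^ t * x t) {t₀ : ℕ} (h0 : x t₀ ≠ 0) :
    ∃ z : ℤ_[p],
      F'.map (PadicComplexInt p).toSubring.subtype =
        C c * (binomPow z).map (PadicComplexInt p).toSubring.subtype *
          F.map (PadicComplexInt p).toSubring.subtype ∧
      d = onePlusPow z (u - 1) := by
  set ι := (PadicComplexInt p).toSubring.subtype with hι
  set f := F.map ι with hf
  set g := F'.map ι with hg
  have hfi : ∀ n, ‖coeff n f‖ ≤ 1 := norm_coeff_map_subtype_le_one F
  have hgi : ∀ n, ‖coeff n g‖ ≤ 1 := norm_coeff_map_subtype_le_one F'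
  have hrel' : ∀ t : ℕ, ∑' n, coeff n g * (u ^ t - 1) ^ n = c * d ^ t * ∑' n, coeff n f * (u ^ t - 1) ^ n := by
    intro t
    rw [tsum_coeff_map_subtype_eq_of_hasValueAt (hx' t), tsum_coeff_map_subtype_eq_of_hasValueAt (hx t)]
    exact hrel t
  have h0' : ∑' n, coeff n f * (u ^ t₀ - 1) ^ n ≠ 0 := by
    rw [tsum_coeff_map_subtype_eq_of_hasValueAt (hx t₀)]; exact h0
  obtain ⟨z, Q, hgQ, hQ, -⟩ :=
    PadicComplex.exists_padicInt_binomial_twist_of_node_values (p := p) hfi hgi hu hroot hc hd hrel' h0'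
  -- `Q = Q(0) • (1+T)^z` by uniqueness of solutions of `(1+X)Q′ = zQ`
  have hzalg : ((algebraMap ℚ_[p] ℂ_[p]) (z : ℚ_[p])) = ((z : ℚ_[p]) : ℂ_[p]) := rfl
  have hB := ode_binomPow_map (p := p) z
  have huniq := constantCoeff_smul_eq_of_ode hQ hB
  rw [← coeff_zero_eq_constantCoeff_apply (φ := (binomPow z).map _), coeff_map_subtype,
    coeff_zero_eq_constantCoeff_apply, constantCoeff_binomPow, OneMemClass.coe_one, one_smul] at huniq
  -- `huniq : Q(0) • (binomPow z).map ι = Q`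
  set q : ℂ_[p] := constantCoeff Q with hq
  have hgq : g = C q * (binomPow z).map ι * f := by
    rw [hgQ, ← huniq, smul_eq_C_mul]
  -- values at the nodes: `x'_t = q·(uᵗ)^z·x_t`
  have hnode : ∀ t : ℕ, ‖u ^ t - 1‖ < 1 := fun t ↦ (ntn_norm_pow_sub_one_le hu t).trans_lt hu
  have hval : ∀ t : ℕ, x' t = q * (onePlusPow z (u ^ t - 1) * x t) := by
    intro t
    have hBF : IntSeries.HasValueAt (binomPow z * F) (u ^ t - 1) (onePlusPow z (u ^ t - 1) * x t) :=
      (hasValueAt_binomPow z (hnode t)).mul (hnode t) (hx t)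
    have h1 := ntn_hasSum_C_mul_map q hBF
    have h2 : HasSum (fun n : ℕ ↦ coeff n g * (u ^ t - 1) ^ n) (x' t) := by
      have h3 := hx' t
      unfold IntSeries.HasValueAt at h3
      refine h3.congr_fun fun n ↦ ?_
      rw [hg, coeff_map_subtype]
    have h4 : (fun n : ℕ ↦ coeff n g * (u ^ t - 1) ^ n) =
        fun n : ℕ ↦ coeff n (C q * (binomPow z * F).map ι) * (u ^ t - 1) ^ n := by
      funext n; rw [hgq, map_mul (PowerSeries.map ι), hf, mul_assoc]
    rw [h4] at h2
    exact h2.unique h1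
  -- two consecutive good nodes: `d = u^z`, then `q = c`
  have hu1 : ‖u‖ = 1 := ntn_norm_eq_one_of_oneUnit hu
  have hu0 : u ≠ 0 := fun h ↦ by rw [h, norm_zero] at hu1; exact zero_ne_one hu1
  have hϖ0 : u - 1 ≠ 0 := fun h1 ↦ hroot 1 one_pos (by rw [pow_one]; exact sub_eq_zero.1 h1)
  have hF0 : F ≠ 0 := by
    intro hF
    apply h0
    have h1 := hx t₀
    rw [hF] at h1
    have h2 : IntSeries.HasValueAt (0 : PowerSeries (PadicComplexInt p)) (u ^ t₀ - 1) 0 := by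
      unfold IntSeries.HasValueAt; simp
    exact h1.unique h2
  have hinj : Function.Injective fun t : ℕ ↦ u ^ t - 1 := by
    have hkey : ∀ s n : ℕ, 0 < n → u ^ s ≠ u ^ (s + n) := by
      intro s n hn h'
      refine hroot n hn (mul_left_cancel₀ (pow_ne_zero s hu0) ?_)
      rw [mul_one, ← pow_add]; exact h'.symm
    intro s s' h'
    have h'' : u ^ s = u ^ s' := sub_left_injective h'
    by_contra hne
    rcases Nat.lt_or_gt_of_ne hne with hlt | hlt
    · have h2 := hkey s (s' - s) (Nat.sub_pos_of_lt hlt)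
      rw [Nat.add_sub_cancel' hlt.le] at h2; exact h2 h''
    · have h2 := hkey s' (s - s') (Nat.sub_pos_of_lt hlt)
      rw [Nat.add_sub_cancel' hlt.le] at h2; exact h2 h''.symm
  have hfin : {t : ℕ | x t = 0}.Finite := by
    by_contra hinf
    apply hF0
    refine eq_zero_of_infinite_zeros hϖ0 hu ?_
    have himage : ((fun t : ℕ ↦ u ^ t - 1) '' {t : ℕ | x t = 0}).Infinite :=
      (Set.not_finite.1 hinf).image hinj.injOn
    refine himage.mono ?_
    rintro y ⟨t, ht, rfl⟩
    refine ⟨ntn_norm_pow_sub_one_le hu t, ?_⟩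
    have := hx t
    rwa [show x t = 0 from ht] at this
  obtain ⟨N, hN⟩ := hfin.bddAbove
  have hgood : ∀ t, N < t → x t ≠ 0 := fun t ht hxt ↦ absurd (hN hxt) (not_le.2 ht)
  -- at a good node: `c·dᵗ = q·(uᵗ)^z`
  have hratio : ∀ t, x t ≠ 0 → c * d ^ t = q * onePlusPow z (u ^ t - 1) := by
    intro t ht
    have h := hval t
    rw [hrel t, ← mul_assoc] at h
    exact mul_right_cancel₀ ht h
  have h1 := hratio (N + 1) (hgood _ (by omega))
  have h2 := hratio (N + 2) (hgood _ (by omega))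
  rw [show N + 2 = (N + 1) + 1 from rfl, onePlusPow_pow_succ_sub_one z hu (N + 1), ← mul_assoc, ← h1,
    pow_succ, ← mul_assoc] at h2
  have hdz : d = onePlusPow z (u - 1) := mul_left_cancel₀ (mul_ne_zero hc (pow_ne_zero _ hd)) h2
  -- then `q = c`
  have hqc : q = c := by
    have h3 := h1
    rw [hdz] at h3
    -- `c * (u^z)^(N+1) = q * (u^{N+1})^z`; and `(u^{N+1})^z = (u^z)^{N+1}`
    have hpow : ∀ t : ℕ, onePlusPow z (u ^ t - 1) = onePlusPow z (u - 1) ^ t := by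
      intro t
      induction t with
      | zero =>
        rw [pow_zero, pow_zero, sub_self]
        have h := IntSeries.norm_onePlusPow_sub_one_le z (x := (0 : ℂ_[p])) (by rw [norm_zero]; exact one_pos)
        rw [norm_zero] at h
        exact sub_eq_zero.mp (norm_le_zero_iff.mp h)
      | succ t ih => rw [onePlusPow_pow_succ_sub_one z hu t, ih, pow_succ]
    rw [hpow] at h3
    have hne : onePlusPow z (u - 1) ^ (N + 1) ≠ 0 := by
      rw [← hdz]; exact pow_ne_zero _ hd
    exact (mul_right_cancel₀ hne h3).symm
  refine ⟨z, ?_, hdz⟩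
  rw [← hqc]
  exact hgq

/-- **Integral constant: the identity in `𝒪_{ℂ_p}⟦T⟧`.** In the setting of
`map_eq_C_mul_binomPow_mul_of_values_proportional`, if the constant `c` lies in `𝒪_{ℂ_p}` then
`F' = C c · binomPow z · F` in `𝒪_{ℂ_p}⟦T⟧` and `d = u^z`.
[cite: Gouvea1993PadicNumbers, §5.9 Lemma 5.9.1 (converse) and Problem 194]
[cite: Robert2000PadicAnalysis, Ch. V §2.4 Theorem 1; Ch. VI §2.1 Theorem (Strassman)] -/
theorem eq_C_mul_binomPow_mul_of_values_proportional {F F' : PowerSeries (PadicComplexInt p)}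
    {u d : ℂ_[p]} {c : PadicComplexInt p} {x x' : ℕ → ℂ_[p]} (hu : ‖u - 1‖ < 1)
    (hroot : ∀ n : ℕ, 0 < n → u ^ n ≠ 1) (hc : (c : ℂ_[p]) ≠ 0) (hd : d ≠ 0)
    (hx : ∀ t : ℕ, IntSeries.HasValueAt F (u ^ t - 1) (x t))
    (hx' : ∀ t : ℕ, IntSeries.HasValueAt F' (u ^ t - 1) (x' t))
    (hrel : ∀ t : ℕ, x' t = (c : ℂ_[p]) * d ^ t * x t) {t₀ : ℕ} (h0 : x t₀ ≠ 0) :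
    ∃ z : ℤ_[p], F' = C c * binomPow z * F ∧ d = onePlusPow z (u - 1) := by
  obtain ⟨z, hz, hdz⟩ := map_eq_C_mul_binomPow_mul_of_values_proportional hu hroot hc hd hx hx' hrel h0
  refine ⟨z, map_subtype_injective (p := p) ?_, hdz⟩
  change F'.map _ = (C c * binomPow z * F).map _
  rw [hz, map_mul, map_mul, map_C]
  rfl

end Literature.NumberTheory.EllipticCurves.IntSeries

end
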